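import Summits.CriticalPhenomena.PercolationContinuityZ3.Theorems.PercNearOneGluingNoHeavyQuantDominantPieces
import HarnessLib

/-!
# QUANT lane R8, T-DEC: the dominant-layer closure FROM WINDOW DATA — part 1 (window forms of the one-factor lemmas; a vacuity lemma)

builds on p205010 (kernel theorem, internal audit signed; external expert review pending)

Support file (`--supports stmt-CriticalPhenomena-4575`), QUANT lane seat prim-quant-arm-2 (gen 34), rung R8 of
`run/shared/lean/prim/quant/LADDER.md`.  Theorems only (no definitions), standard axioms, no sorries.  Part 1 of 2: part 2
`…QuantConvClosedTDominant` proves `LawDec.ConvClosedT` (leg (II)'s statement of record, cone form with WINDOWS of layers and explicit targets,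
`…QuantSliceConeForm`) at every dominant layer `2j < T₁ + T₂` in its own binder.  `…QuantDominantPieces` / `…QuantDominantClosure` assumed the
two-layer giant bounds of the factors at ALL pairs of layers; the versions here take them only at the layers the proof reads:
`piece_ge_w` — factor 2's bounds at the layers `a ∈ [j − K, j]` (`κ ≤ K`); `profile_minorant_w` — factor 1's bounds at the single layer `j − s`.
`target_le_two_top_of_decAtT` is the vacuity lemma that disposes of the degenerate regimes of the window binder: a law on `{0..M}` that is
DEC at a layer `i ≥ M` for the target `T` has `T ≤ 2M` (every valid component there is a self-sufficient point or a credit pair, both `≤ M`).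

* `LawDec.piece_ge_w`, `LawDec.profile_minorant_w` — window forms of `piece_ge`, `profile_minorant` (same proofs).
* `LawDec.target_le_two_top_of_decAtT` — `DECAtT x T i M μ`, `M ≤ i`, `0 < x < 1` ⟹ `T ≤ 2M`.

[this work]; DEC rules ARCH-TREES-G49 §2.2 / DEC-TAMP-G50 §3.1 (this lane).  Nothing here is cited as a published result.  The gluing rows
served [cite: KozmaNitzan2024, Conjecture 3 (p. 15)]; product measure [cite: Grimmett1999, §1.3 p. 10].
-/

noncomputable section

namespace Summit.CriticalPhenomena.PercolationContinuityZ3.Theorems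

namespace Quant

open Finset

/-- the mass of `μ` (a law on `{0..M}`) strictly above the layer `a` -/
local notation3 "TAIL[" μ ", " M ", " a "]" =>
  ∑ h ∈ Finset.range ((M : ℕ) + 1), (if (a : ℕ) + 1 ≤ h then (μ : ℕ → ℝ) h else 0)

/-- the mass of `μ` (a law on `{0..M}`) at or below the layer `a` -/
local notation3 "LOW[" μ ", " M ", " a "]" =>
  ∑ h ∈ Finset.range ((M : ℕ) + 1), (if h ≤ (a : ℕ) then (μ : ℕ → ℝ) h else 0)

namespace LawDec

/-! ### Window forms of the one-factor lemmas -/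

/-- **`piece_ge` from window data**: as `piece_ge`, the two-layer bounds of `gate_q μ₂` being assumed only at the layers `a ≤ j` with
`j ≤ a + K`, for a shift `0 ≤ κ ≤ K`. [this work] -/
theorem piece_ge_w (y q t₁ t₂ κ : ℝ) (j M₂ K : ℕ) (μ₂ : ℕ → ℝ) (hy0 : 0 < y) (hyq : y ≤ q) (hq1 : q ≤ 1)
    (h20 : ∀ h, 0 ≤ μ₂ h) (h21 : ∑ h ∈ Finset.range (M₂ + 1), μ₂ h = 1)
    (hdl2 : ∀ a i' : ℕ, i' ≤ a → a ≤ j → j ≤ a + K → (a : ℝ) + i' < t₂ →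
      y * (1 - q * TAIL[μ₂, M₂, i']) ≤ (1 - y) * (q * TAIL[μ₂, M₂, a]))
    (hκ : 0 ≤ κ) (hκK : κ ≤ K) (hdom : 2 * (j : ℝ) < t₁ + t₂) (hcase : q * TAIL[μ₂, M₂, j] ≤ y) :
    y ≤ ∑ s ∈ Finset.range (M₂ + 1), μ₂ s * (if j + 1 ≤ s then q else
      ((if (j : ℝ) < s + κ then (1 : ℝ) else 0) + y * (if (s : ℝ) + κ ≤ j ∧ (j : ℝ) + κ < t₁ + s then (1 : ℝ) else 0))) := by
  have hq0 : 0 < q := hy0.trans_le hyq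
  have hG0 : ∀ a : ℕ, 0 ≤ TAIL[μ₂, M₂, a] := fun a => Finset.sum_nonneg fun h _ => by split_ifs; exacts [h20 h, le_rfl]
  have hGL : ∀ a : ℕ, LOW[μ₂, M₂, a] + TAIL[μ₂, M₂, a] = 1 := fun a => by rw [sum_le_add_sum_gt, h21]
  have hL0 : ∀ a : ℕ, 0 ≤ LOW[μ₂, M₂, a] := fun a => Finset.sum_nonneg fun h _ => by split_ifs; exacts [h20 h, le_rfl]
  have hGanti : ∀ a b : ℕ, a ≤ b → TAIL[μ₂, M₂, b] ≤ TAIL[μ₂, M₂, a] := fun a b hab => sum_gt_antitone M₂ b a μ₂ h20 hab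
  -- split the sum into its three indicator sums
  have hsplit : ∑ s ∈ Finset.range (M₂ + 1), μ₂ s * (if j + 1 ≤ s then q else
      ((if (j : ℝ) < s + κ then (1 : ℝ) else 0) + y * (if (s : ℝ) + κ ≤ j ∧ (j : ℝ) + κ < t₁ + s then (1 : ℝ) else 0)))
      = q * TAIL[μ₂, M₂, j] + ∑ s ∈ Finset.range (M₂ + 1), (if s ≤ j ∧ (j : ℝ) < s + κ then μ₂ s else 0)
        + y * ∑ s ∈ Finset.range (M₂ + 1), (if (s : ℝ) + κ ≤ j ∧ (j : ℝ) + κ < t₁ + s then μ₂ s else 0) := by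
    rw [Finset.mul_sum, Finset.mul_sum, ← Finset.sum_add_distrib, ← Finset.sum_add_distrib]
    refine Finset.sum_congr rfl fun s _ => ?_
    by_cases hs : j + 1 ≤ s
    · have hs' : (j : ℝ) + 1 ≤ s := by exact_mod_cast hs
      rw [if_pos hs, if_pos hs, if_neg (show ¬ (s ≤ j ∧ (j : ℝ) < s + κ) by omega),
        if_neg (show ¬ ((s : ℝ) + κ ≤ j ∧ (j : ℝ) + κ < t₁ + s) from fun h => by rcases h with ⟨h1, _⟩; linarith)]; ring
    · rw [if_neg hs, if_neg hs]
      by_cases h1 : (j : ℝ) < s + κ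
      · rw [if_pos h1, if_pos (show s ≤ j ∧ (j : ℝ) < s + κ from ⟨by omega, h1⟩)]; split_ifs <;> ring
      · rw [if_neg h1, if_neg (show ¬ (s ≤ j ∧ (j : ℝ) < s + κ) from fun h => h1 h.2)]; split_ifs <;> ring
  rw [hsplit]
  by_cases hκj : (j : ℝ) < κ
  · -- every `s ≤ j` has `j < s + κ`: the middle sum is all of `μ₂{≤ j}`
    have hmid : ∑ s ∈ Finset.range (M₂ + 1), (if s ≤ j ∧ (j : ℝ) < s + κ then μ₂ s else 0) = LOW[μ₂, M₂, j] :=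
      Finset.sum_congr rfl fun s _ => by
        by_cases hs : s ≤ j
        · rw [if_pos ⟨hs, by linarith [(Nat.cast_nonneg s : (0 : ℝ) ≤ s)]⟩, if_pos hs]
        · rw [if_neg (fun h => hs h.1), if_neg hs]
    have h3 : 0 ≤ ∑ s ∈ Finset.range (M₂ + 1), (if (s : ℝ) + κ ≤ j ∧ (j : ℝ) + κ < t₁ + s then μ₂ s else 0) :=
      Finset.sum_nonneg fun s _ => by split_ifs; exacts [h20 s, le_rfl]
    rw [hmid]
    have := hGL j
    nlinarith [hG0 j, mul_nonneg hy0.le h3]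
  · have hκj' : κ ≤ (j : ℝ) := not_lt.1 hκj
    have hx0 : 0 ≤ (j : ℝ) - κ := by linarith
    set a : ℕ := ⌊(j : ℝ) - κ⌋₊ with ha
    have ha1 : (a : ℝ) ≤ j - κ := Nat.floor_le hx0
    have ha2 : (j : ℝ) - κ < a + 1 := Nat.lt_floor_add_one _
    have haj : a ≤ j := by
      have : (a : ℝ) ≤ j := by linarith
      exact_mod_cast this
    have haK : j ≤ a + K := by
      have h1 : (j : ℝ) < (a : ℝ) + 1 + K := by linarith
      have h2 : j < a + 1 + K := by exact_mod_cast h1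
      omega
    -- the middle sum is `μ₂(a, j]`
    have hmid : ∑ s ∈ Finset.range (M₂ + 1), (if s ≤ j ∧ (j : ℝ) < s + κ then μ₂ s else 0) + TAIL[μ₂, M₂, j] = TAIL[μ₂, M₂, a] := by
      rw [← Finset.sum_add_distrib]
      refine Finset.sum_congr rfl fun s _ => ?_
      have e : ((j : ℝ) < s + κ) ↔ a + 1 ≤ s := by
        rw [show ((j : ℝ) < s + κ) ↔ ((j : ℝ) - κ < s) from ⟨fun h => by linarith, fun h => by linarith⟩, ← Nat.floor_lt hx0]
        exact Nat.lt_iff_add_one_le  -- `a < s ↔ a + 1 ≤ s`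
      by_cases hs1 : a + 1 ≤ s
      · by_cases hs2 : s ≤ j
        · rw [if_pos ⟨hs2, e.2 hs1⟩, if_neg (by omega), if_pos hs1, add_zero]
        · rw [if_neg (fun h => hs2 h.1), if_pos (by omega), if_pos hs1, zero_add]
      · rw [if_neg (fun h => hs1 (e.1 h.2)), if_neg (by omega), if_neg hs1, add_zero]
    -- the deep sum
    set u : ℝ := (j : ℝ) + κ - t₁ with hu
    have econd : ∀ s : ℕ, ((s : ℝ) + κ ≤ j ∧ (j : ℝ) + κ < t₁ + s) ↔ (s ≤ a ∧ u < s) := by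
      intro s
      rw [Nat.le_floor_iff hx0]
      exact ⟨fun ⟨h1, h2⟩ => ⟨by linarith, by rw [hu]; linarith⟩, fun ⟨h1, h2⟩ => ⟨by linarith, by rw [hu] at h2; linarith⟩⟩
    have hdeep : ∑ s ∈ Finset.range (M₂ + 1), (if (s : ℝ) + κ ≤ j ∧ (j : ℝ) + κ < t₁ + s then μ₂ s else 0)
        = ∑ s ∈ Finset.range (M₂ + 1), (if s ≤ a ∧ u < s then μ₂ s else 0) :=
      Finset.sum_congr rfl fun s _ => by simp only [econd s]
    rw [hdeep]
    by_cases hu0 : u < 0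
    · -- every `s ≤ a` is deep
      have hd : ∑ s ∈ Finset.range (M₂ + 1), (if s ≤ a ∧ u < s then μ₂ s else 0) = LOW[μ₂, M₂, a] :=
        Finset.sum_congr rfl fun s _ => by
          by_cases hs : s ≤ a
          · rw [if_pos ⟨hs, by linarith [(Nat.cast_nonneg s : (0 : ℝ) ≤ s)]⟩, if_pos hs]
          · rw [if_neg (fun h => hs h.1), if_neg hs]
      rw [hd]
      have e1 := hGL a
      have e2 := hGanti a j haj
      have e3 : (1 - y) * TAIL[μ₂, M₂, j] ≤ (1 - y) * TAIL[μ₂, M₂, a] := mul_le_mul_of_nonneg_left e2 (by linarith)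
      have e4 : 0 ≤ (q - y) * TAIL[μ₂, M₂, j] := mul_nonneg (by linarith) (hG0 j)
      nlinarith
    · have hu0' : 0 ≤ u := not_lt.1 hu0
      set i' : ℕ := ⌊u⌋₊ with hi'
      have hi'1 : (i' : ℝ) ≤ u := Nat.floor_le hu0'
      have econd' : ∀ s : ℕ, (u < s) ↔ i' + 1 ≤ s := fun s => by
        rw [← Nat.floor_lt hu0']; exact Nat.lt_iff_add_one_le
      by_cases hia : i' ≤ a
      · -- the deep sum is `μ₂(i', a]`; one two-layer bound at `(a, i')`
        have hd : ∑ s ∈ Finset.range (M₂ + 1), (if s ≤ a ∧ u < s then μ₂ s else 0) + TAIL[μ₂, M₂, a] = TAIL[μ₂, M₂, i'] := by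
          rw [← Finset.sum_add_distrib]
          refine Finset.sum_congr rfl fun s _ => ?_
          by_cases hs1 : i' + 1 ≤ s
          · by_cases hs2 : s ≤ a
            · rw [if_pos ⟨hs2, (econd' s).2 hs1⟩, if_neg (by omega), if_pos hs1, add_zero]
            · rw [if_neg (fun h => hs2 h.1), if_pos (by omega), if_pos hs1, zero_add]
          · rw [if_neg (fun h => hs1 ((econd' s).1 h.2)), if_neg (by omega), if_neg hs1, add_zero]
        have key := hdl2 a i' hia haj haK (by linarith)
        have e3 : (1 - q) * (q * TAIL[μ₂, M₂, j]) ≤ (1 - q) * y := mul_le_mul_of_nonneg_left hcase (by linarith)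
        -- `q·(total) ≥ q·y`
        have htot : q * y ≤ q * (q * TAIL[μ₂, M₂, j] + ∑ s ∈ Finset.range (M₂ + 1), (if s ≤ j ∧ (j : ℝ) < s + κ then μ₂ s else 0)
            + y * ∑ s ∈ Finset.range (M₂ + 1), (if s ≤ a ∧ u < s then μ₂ s else 0)) := by
          have e5 : q * (q * TAIL[μ₂, M₂, j] + ∑ s ∈ Finset.range (M₂ + 1), (if s ≤ j ∧ (j : ℝ) < s + κ then μ₂ s else 0)
              + y * ∑ s ∈ Finset.range (M₂ + 1), (if s ≤ a ∧ u < s then μ₂ s else 0))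
              = (1 - y) * (q * TAIL[μ₂, M₂, a]) + y * (q * TAIL[μ₂, M₂, i']) - (1 - q) * (q * TAIL[μ₂, M₂, j]) := by
            rw [show ∑ s ∈ Finset.range (M₂ + 1), (if s ≤ j ∧ (j : ℝ) < s + κ then μ₂ s else 0)
                = TAIL[μ₂, M₂, a] - TAIL[μ₂, M₂, j] by rw [← hmid]; ring,
              show ∑ s ∈ Finset.range (M₂ + 1), (if s ≤ a ∧ u < s then μ₂ s else 0)
                = TAIL[μ₂, M₂, i'] - TAIL[μ₂, M₂, a] by rw [← hd]; ring]
            ring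
          rw [e5]
          nlinarith
        exact le_of_mul_le_mul_left htot hq0
      · -- no deep atom: the far row of `gate_q μ₂` at the dominant layer `a`
        have hia' : a < i' := not_le.1 hia
        have hd : ∑ s ∈ Finset.range (M₂ + 1), (if s ≤ a ∧ u < s then μ₂ s else 0) = 0 :=
          Finset.sum_eq_zero fun s _ => if_neg fun h => by have := (econd' s).1 h.2; omega
        have hau : (a : ℝ) + 1 ≤ u := by
          have : ((a + 1 : ℕ) : ℝ) ≤ i' := by exact_mod_cast hia'
          push_cast at this; linarith
        have key := hdl2 a a le_rfl haj haK (by linarith)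
        have e3 : (1 - q) * (q * TAIL[μ₂, M₂, j]) ≤ (1 - q) * y := mul_le_mul_of_nonneg_left hcase (by linarith)
        have htot : q * y ≤ q * (q * TAIL[μ₂, M₂, j] + ∑ s ∈ Finset.range (M₂ + 1), (if s ≤ j ∧ (j : ℝ) < s + κ then μ₂ s else 0)
            + y * ∑ s ∈ Finset.range (M₂ + 1), (if s ≤ a ∧ u < s then μ₂ s else 0)) := by
          rw [hd, mul_zero, add_zero, show ∑ s ∈ Finset.range (M₂ + 1), (if s ≤ j ∧ (j : ℝ) < s + κ then μ₂ s else 0)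
                = TAIL[μ₂, M₂, a] - TAIL[μ₂, M₂, j] by rw [← hmid]; ring]
          nlinarith [hG0 i', hG0 a]
        exact le_of_mul_le_mul_left htot hq0


/-- **`profile_minorant` from one layer**: as `profile_minorant`, the two-layer bounds of `ν` being assumed only at the layer `j − s`
(written without subtraction: `i′ + s ≤ j`, `j + i′ < t + s`, tail `ν{h : j+1 ≤ h+s}`). [this work] -/
theorem profile_minorant_w (y t : ℝ) (j s M : ℕ) (ν : ℕ → ℝ) (hy1 : y ≤ 1) (hν0 : ∀ h, 0 ≤ ν h)
    (hν1 : ∑ h ∈ Finset.range (M + 1), ν h = 1)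
    (hdl : ∀ i' : ℕ, i' + s ≤ j → (j : ℝ) + i' < t + s →
      y * LOW[ν, M, i'] ≤ (1 - y) * ∑ h ∈ Finset.range (M + 1), (if j + 1 ≤ h + s then ν h else 0)) (hsj : s ≤ j) :
    ∑ k ∈ Finset.range (M + 1), (if 2 * (k : ℝ) < t then ν k else 0)
        * ((if (j : ℝ) < s + k then (1 : ℝ) else 0) + y * (if (s : ℝ) + k ≤ j ∧ (j : ℝ) + k < t + s then (1 : ℝ) else 0))
      + ((∑ k ∈ Finset.range (M + 1), (if 2 * (k : ℝ) < t then 0 else ν k)) - y) * (if (j : ℝ) < s + t / 2 then (1 : ℝ) else 0)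
      ≤ (1 - y) * ∑ h ∈ Finset.range (M + 1), (if j + 1 ≤ h + s then ν h else 0) := by
  obtain ⟨i, rfl⟩ : ∃ i, j = i + s := ⟨j - s, by omega⟩
  push_cast
  have htail : ∑ h ∈ Finset.range (M + 1), (if i + s + 1 ≤ h + s then ν h else 0) = TAIL[ν, M, i] :=
    Finset.sum_congr rfl fun h _ => by
      by_cases hh : i + 1 ≤ h
      · rw [if_pos (by omega), if_pos hh]
      · rw [if_neg (by omega), if_neg hh]
  rw [htail]
  have hT0 : 0 ≤ TAIL[ν, M, i] := Finset.sum_nonneg fun h _ => by split_ifs; exacts [hν0 h, le_rfl]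
  have hLT : LOW[ν, M, i] + TAIL[ν, M, i] = 1 := by rw [sum_le_add_sum_gt, hν1]
  by_cases hdomi : 2 * (i : ℝ) < t
  · -- dominant layer: an identity
    rw [if_pos (by linarith : (i : ℝ) + s < s + t / 2), mul_one]
    have hpt : ∀ k ∈ Finset.range (M + 1),
        (if 2 * (k : ℝ) < t then ν k else 0) * ((if (i : ℝ) + s < s + k then (1 : ℝ) else 0)
            + y * (if (s : ℝ) + k ≤ i + s ∧ (i : ℝ) + s + k < t + s then (1 : ℝ) else 0))
          + (if 2 * (k : ℝ) < t then 0 else ν k)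
          = (if i + 1 ≤ k then ν k else 0) + y * (if k ≤ i then ν k else 0) := by
      intro k _
      by_cases hki : k ≤ i
      · have hk' : (k : ℝ) ≤ i := by exact_mod_cast hki
        rw [if_pos (by linarith : 2 * (k : ℝ) < t), if_pos (by linarith : 2 * (k : ℝ) < t),
          if_neg (by linarith : ¬ ((i : ℝ) + s < s + k)),
          if_pos (⟨by linarith, by linarith⟩ : (s : ℝ) + k ≤ i + s ∧ (i : ℝ) + s + k < t + s),
          if_neg (by omega : ¬ (i + 1 ≤ k)), if_pos hki]
        ring
      · have hk' : (i : ℝ) < k := by exact_mod_cast (not_le.1 hki)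
        rw [if_pos (by linarith : (i : ℝ) + s < s + k), if_pos (by omega : i + 1 ≤ k), if_neg hki,
          if_neg (show ¬ ((s : ℝ) + k ≤ i + s ∧ (i : ℝ) + s + k < t + s) from fun h => by rcases h with ⟨h1, _⟩; linarith)]
        split_ifs <;> ring
    have hsum : ∑ k ∈ Finset.range (M + 1), (if 2 * (k : ℝ) < t then ν k else 0) * ((if (i : ℝ) + s < s + k then (1 : ℝ) else 0)
            + y * (if (s : ℝ) + k ≤ i + s ∧ (i : ℝ) + s + k < t + s then (1 : ℝ) else 0))
          + ∑ k ∈ Finset.range (M + 1), (if 2 * (k : ℝ) < t then 0 else ν k) = TAIL[ν, M, i] + y * LOW[ν, M, i] := by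
      rw [← Finset.sum_add_distrib, Finset.sum_congr rfl hpt, Finset.sum_add_distrib, ← Finset.mul_sum]
    nlinarith
  · -- non-dominant layer
    have hdomi' : t ≤ 2 * (i : ℝ) := not_lt.1 hdomi
    rw [if_neg (by linarith : ¬ ((i : ℝ) + s < s + t / 2)), mul_zero, add_zero]
    have hpt : ∀ k ∈ Finset.range (M + 1),
        (if 2 * (k : ℝ) < t then ν k else 0) * ((if (i : ℝ) + s < s + k then (1 : ℝ) else 0)
            + y * (if (s : ℝ) + k ≤ i + s ∧ (i : ℝ) + s + k < t + s then (1 : ℝ) else 0))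
          = y * (if (i : ℝ) + k < t then ν k else 0) := by
      intro k _
      by_cases hik : (i : ℝ) + k < t
      · rw [if_pos (by linarith : 2 * (k : ℝ) < t), if_neg (by linarith : ¬ ((i : ℝ) + s < s + k)),
          if_pos (⟨by linarith, by linarith⟩ : (s : ℝ) + k ≤ i + s ∧ (i : ℝ) + s + k < t + s), if_pos hik]
        ring
      · rw [if_neg hik, if_neg (show ¬ ((s : ℝ) + k ≤ i + s ∧ (i : ℝ) + s + k < t + s) from
          fun h => hik (by rcases h with ⟨_, h2⟩; linarith))]
        by_cases h2k : 2 * (k : ℝ) < t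
        · rw [if_pos h2k, if_neg (by linarith : ¬ ((i : ℝ) + s < s + k))]; ring
        · rw [if_neg h2k]; ring
    rw [Finset.sum_congr rfl hpt, ← Finset.mul_sum]
    by_cases hti : t ≤ i
    · have hz : ∑ k ∈ Finset.range (M + 1), (if (i : ℝ) + k < t then ν k else 0) = 0 :=
        Finset.sum_eq_zero fun k _ => if_neg (by linarith [(Nat.cast_nonneg k : (0 : ℝ) ≤ k)])
      rw [hz, mul_zero]
      exact mul_nonneg (by linarith) hT0
    · have hti' : (i : ℝ) < t := not_le.1 hti
      set n : ℕ := ⌈t - (i : ℝ)⌉₊ with hn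
      have hn0 : 0 < n := Nat.ceil_pos.2 (by linarith)
      have hn1 : (((n - 1 : ℕ) : ℝ)) < t - i := by
        have : n - 1 < n := by omega
        rw [hn] at this
        exact (Nat.lt_ceil).1 this
      have hni : n - 1 ≤ i := by
        have : (((n - 1 : ℕ) : ℝ)) < i := by linarith
        exact_mod_cast this.le
      have hz : ∑ k ∈ Finset.range (M + 1), (if (i : ℝ) + k < t then ν k else 0) = LOW[ν, M, n - 1] :=
        Finset.sum_congr rfl fun k _ => by
          have e : ((i : ℝ) + k < t) ↔ k ≤ n - 1 := by
            rw [show ((i : ℝ) + k < t) ↔ ((k : ℝ) < t - i) from ⟨fun h => by linarith, fun h => by linarith⟩, ← Nat.lt_ceil, ← hn]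
            omega
          simp only [e]
      rw [hz]
      have h := hdl (n - 1) (by omega) (by push_cast; linarith)
      rwa [htail] at h


/-! ### The vacuity lemma -/

/-- **a law DEC at a layer at or above its top has target at most twice the top**: `DECAtT x T i M μ` with `M ≤ i` (`0 < x < 1`) forces
`T ≤ 2M` — a genuine component is a point `k ≤ M` with `T ≤ 2k` (a point above `i ≥ M` is impossible), or a credit pair with
`T ≤ 2lo + (hi−lo)κ ≤ lo + hi ≤ 2M` (`κ ≤ 1`); a giant pair needs `hi > i ≥ M`. [this work] -/
theorem target_le_two_top_of_decAtT (x T : ℝ) (i M : ℕ) (μ : ℕ → ℝ) (hx0 : 0 < x) (hx1 : x < 1) (hMi : M ≤ i)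
    (h : DECAtT x T i M μ) : T ≤ 2 * (M : ℝ) := by
  classical
  obtain ⟨ρ, hρ, lam, g, lo, hi, h0, h1, hg, hlohi, hhi, _, hval⟩ := h
  -- a genuine component exists
  obtain ⟨r, hr⟩ : ∃ r, 0 < lam r := by
    by_contra hc
    push Not at hc
    have : ∑ r, lam r ≤ 0 := Finset.sum_nonpos fun r _ => hc r
    linarith
  have hhiM : (hi r : ℝ) ≤ M := by exact_mod_cast hhi r
  have hloM : (lo r : ℝ) ≤ M := by exact_mod_cast (hlohi r).trans (hhi r)
  rcases hval r hr with ⟨heq, hS⟩ | ⟨_, hgi, _⟩ | ⟨hlt, _, hcr⟩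
  · rcases hS with h2 | h2
    · linarith
    · exfalso
      have := hhi r
      rw [← heq] at this
      omega
  · exfalso
    have := hhi r
    omega
  · have hκ : (if x ≤ g r then g r else (g r - x ^ 2) / (1 - x)) ≤ 1 := by
      split_ifs with hxg
      · exact (hg r).2
      · rw [div_le_one (by linarith)]
        nlinarith [(hg r).1, not_le.1 hxg]
    have hd : (0 : ℝ) ≤ (hi r : ℝ) - lo r := by
      have : (lo r : ℝ) ≤ hi r := by exact_mod_cast hlt.le
      linarith
    have := mul_le_mul_of_nonneg_left hκ hd
    linarith

end LawDec

end Quant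

end Summit.CriticalPhenomena.PercolationContinuityZ3.Theorems
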